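import Summits.HodgeConjecture.HodgeConjecture.Theorems.Ring2WeilCoverageWeilGramLevel21Principal
import Summits.HodgeConjecture.HodgeConjecture.Theorems.Ring2WeilCoverageWeilGramLevel28SqrtNegSeven
import Summits.HodgeConjecture.HodgeConjecture.Theorems.Ring2WeilCoverageWeilGramLevel36SqrtNegThree
import Summits.HodgeConjecture.HodgeConjecture.Theorems.Ring2WeilCoverageWeilTypeBalance
import Summits.HodgeConjecture.HodgeConjecture.Theorems.Ring2WeilCoverageResidueDictionaryRowsA
import Summits.HodgeConjecture.HodgeConjecture.Theorems.Ring2WeilCoverageCMTypeSignParity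
import HarnessLib

/-!
# Weil-type family coverage — the three `g = 6` census NO rows `(21, ℚ(√−3))`, `(28, ℚ(√−7))`, `(36, ℚ(√−3))` in their
# OWN phrasing (`N_K`-balanced CM types), re-proved through van Geemen's SIGN: a second kernel route to
# `not_exists_principal_twentyOne/_twentyEight/_thirtySix` (THEOREM L via unit signatures)

research route conditional on HC_CM; not a corollary; Q11.4-sentence-2 already refuted in dim ≥ 3.

Ring 2, WEIL-TYPE FAMILY-COVERAGE CENSUS (`HOME/WEIL-FAMILY-COVERAGE.md` `## b01`, block b01.48; owner ring2-b01), part 117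
of the `Ring2WeilCoverage*` series — the `g = 6` edition of parts 96/97.  Parts 99/106/111 proved: no principal-type `ζ′` on
`ℤ[ζ_M]` is `Φ`-positive on a CM type of `s`-signature `(3,3)` (`det a = +1728, +21952, +1728 > 0` against
`0 < (−1)³ det a`, part 92).  The census phrases «Weil type for `K_d`» by the residue set: `Φ` is BALANCED for `N_K`
(`2|S_Φ ∩ N_K| = |S_Φ|`).  The residue dictionary rows of part 27 (`ResidueDictionaryRowsA.nK_twentyOne_sqrt_neg_three`,
`nK_twentyEight_sqrt_neg_seven`, `nK_thirtySix_sqrt_neg_three`: `Im φ(s) < 0 ↔ t ∈ N_K`) and part 28's bridge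
`two_mul_card_inter_eq_card_iff` turn «`N_K`-balanced» into «`s`-signature `(3,3)`», so:

* **`not_pos_of_principal_twentyOne_sqrt_neg_three`**: for every `{2, 5, 8, 11, 17, 20}`-balanced CM type `Φ` of
  `ℚ(ζ₂₁)` and every skew principal-type `ζ′` on `ℤ[ζ₂₁]`, `ζ′` is not `Φ`-positive;
* **`not_pos_of_principal_twentyEight_sqrt_neg_seven`** (`N_K = {3, 5, 13, 17, 19, 27}`);
* **`not_pos_of_principal_thirtySix_sqrt_neg_three`** (`N_K = {5, 11, 17, 23, 29, 35}`)

— the statements of `not_exists_principal_twentyOne/_twentyEight/_thirtySix` (b01.34: no real unit has the required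
signs), obtained from `det H > 0` against `(−1)³ det H > 0` ([vG94 Lemma 5.2 (4)]): two independent kernel routes to the
same three census cells.

HONEST FRAMING as parts 98–116; `HC_CM` is used nowhere.  No `def`, no named fact, no `sorry`.

References: [cite: vanGeemen1994HodgeAV, Lemma 5.2 (2)–(4)]; [cite: Shimura1998, §14.3 Prop. 4–5, pp. 103–104];
[cite: Aoki2002CMFermatType, §1 (p. 102)] (residue sets of CM types); census b01.34, b01.41, b01.48 (seat-derived).
-/

noncomputable section

open Polynomial NumberField Module Complex Finset
open scoped nonZeroDivisors Real

namespace Summit.HodgeConjecture.Ring2WeilCoverage.WeilGramSixfoldNoPrincipalRows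

open Literature.AlgebraicGeometry.Motives (CMType)
open Literature.NumberTheory.ComplexMultiplication
open Summit.HodgeConjecture.Ring2WeilCoverage.WeilTypeBalance (two_mul_card_inter_eq_card_iff)
open Summit.HodgeConjecture.Ring2WeilCoverage.ResidueDictionaryRowsA
  (nK_twentyOne_sqrt_neg_three nK_twentyEight_sqrt_neg_seven nK_thirtySix_sqrt_neg_three)
open Summit.HodgeConjecture.Ring2WeilCoverage.CMTypeSignParity (card_filter_subtype_eq_ncard im_embedding_ne_zero_of_skew)

variable {K : Type} [Field K] [NumberField K] {ζ : K}

/-- `𝐞(t) = exp(2πi t/n) ∈ ℂ` (`ZMod.toCircle`). -/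
local notation3 (prettyPrint := false) "𝐞 " t:max => ((ZMod.toCircle t : Circle) : ℂ)

open scoped Classical in
/-- **The census NO row `(21, ℚ(√−3))` via van Geemen's sign**: for every CM type `Φ` of `ℚ(ζ_21)` balanced for
`N_K = {2, 5, 8, 11, 17, 20}` (the census's Weil-type condition for `ℚ(√−3)`) and every skew `ζ′` of PRINCIPAL type on `ℤ[ζ_21]`, `ζ′`
is not `Φ`-positive — i.e. `ℂ^Φ/Φ(ℤ[ζ_21])` carries no principal `ι`-compatible polarisation (the tree's
`not_exists_principal_twentyOne_sqrt_neg_three` (parts 7/8) / `CyclotomicUnconditional.not_exists_principal_twentyOne`, re-proved: balanced ⟹ `s`-signature `(3,3)` (parts 27/28) ⟹ part 99 `Summit.HodgeConjecture.Ring2WeilCoverage.WeilGramLevel21Principal.not_pos_of_principal_sqrtNegThree`).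
research route conditional on HC_CM; not a corollary; Q11.4-sentence-2 already refuted in dim ≥ 3. [cite: vanGeemen1994HodgeAV, Lemma 5.2 (4)] [cite: Shimura1998, §14.3 Prop. 4–5, pp. 103–104] -/
theorem not_pos_of_principal_twentyOne_sqrt_neg_three [IsCyclotomicExtension {21} ℚ K] [IsCMField K]
    (hζ : IsPrimitiveRoot ζ 21) (Φ : CMType K)
    (hbal : 2 * ((Finset.univ.filter fun t : ZMod 21 => ∃ σ ∈ Φ.1, σ ζ = 𝐞 t) ∩
        ({2, 5, 8, 11, 17, 20} : Finset (ZMod 21))).card =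
      (Finset.univ.filter fun t : ZMod 21 => ∃ σ ∈ Φ.1, σ ζ = 𝐞 t).card)
    {ζ' : K} (hζ' : IsCMField.complexConj K ζ' = -ζ')
    (hT : CMTypeLattice.IsOfType (1 : (FractionalIdeal (𝓞 K)⁰ K)ˣ) ζ' ⊤) :
    ¬ ∀ φ : Φ.1, 0 < (φ.1 ζ').im := by
  have hs := Summit.HodgeConjecture.Ring2WeilCoverage.WeilGramLevel21.complexConj_sqrtNegThree hζ
  have hs0 : ((1 + 2 * ζ ^ 7) : K) ≠ 0 := fun h => by
    have h2 := Summit.HodgeConjecture.Ring2WeilCoverage.WeilGramLevel21.sq_sqrtNegThree hζ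
    rw [h] at h2
    norm_num at h2
  -- balanced for `N_K` ⟺ equal numbers of `φ ∈ Φ` with `Im s^φ < 0` and `> 0` (parts 27/28)
  have heq := (two_mul_card_inter_eq_card_iff hζ (1 + 2 * ζ ^ 7) (NK := ({2, 5, 8, 11, 17, 20} : Finset (ZMod 21)))
    (fun φ t hφ ht => ⟨nK_twentyOne_sqrt_neg_three hφ ht, im_embedding_ne_zero_of_skew hs hs0 φ⟩) Φ).mp hbal
  rw [← card_filter_subtype_eq_ncard Φ (fun ψ => (ψ (1 + 2 * ζ ^ 7)).im < 0),
    ← card_filter_subtype_eq_ncard Φ (fun ψ => 0 < (ψ (1 + 2 * ζ ^ 7)).im)] at heq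
  -- the two counts add up to `#Φ = 6`
  have hcardΦ : Fintype.card Φ.1 = 6 := by
    have h := CMTypeLattice.two_mul_card_eq_finrank Φ
    rw [IsCyclotomicExtension.finrank K (cyclotomic.irreducible_rat (by norm_num : 0 < 21))] at h
    have h12 : Nat.totient 21 = 12 := by decide
    rw [h12] at h
    omega
  have hsum := Finset.card_filter_add_card_filter_not (s := (Finset.univ : Finset Φ.1))
    (fun φ : Φ.1 => 0 < (φ.1 (1 + 2 * ζ ^ 7)).im)
  have hnot : (Finset.univ.filter fun φ : Φ.1 => ¬ 0 < (φ.1 (1 + 2 * ζ ^ 7)).im) =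
      Finset.univ.filter fun φ : Φ.1 => (φ.1 (1 + 2 * ζ ^ 7)).im < 0 := by
    refine Finset.filter_congr fun φ _ => ?_
    have hne := im_embedding_ne_zero_of_skew hs hs0 φ.1
    exact ⟨fun h => lt_of_le_of_ne (not_lt.mp h) hne, fun h => not_lt.mpr h.le⟩
  rw [hnot, Finset.card_univ, hcardΦ] at hsum
  have hneg : (Finset.univ.filter fun φ : Φ.1 => (φ.1 (1 + 2 * ζ ^ 7)).im < 0).card = 3 := by omega
  have hposc : (Finset.univ.filter fun φ : Φ.1 => 0 < (φ.1 (1 + 2 * ζ ^ 7)).im).card = 3 := by omega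
  exact Summit.HodgeConjecture.Ring2WeilCoverage.WeilGramLevel21Principal.not_pos_of_principal_sqrtNegThree hζ Φ hneg hposc hζ' hT

open scoped Classical in
/-- **The census NO row `(28, ℚ(√−7))` via van Geemen's sign**: for every CM type `Φ` of `ℚ(ζ_28)` balanced for
`N_K = {3, 5, 13, 17, 19, 27}` (the census's Weil-type condition for `ℚ(√−7)`) and every skew `ζ′` of PRINCIPAL type on `ℤ[ζ_28]`, `ζ′`
is not `Φ`-positive — i.e. `ℂ^Φ/Φ(ℤ[ζ_28])` carries no principal `ι`-compatible polarisation (the tree's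
`CyclotomicUnconditional.not_exists_principal_twentyEight`, re-proved: balanced ⟹ `s`-signature `(3,3)` (parts 27/28) ⟹ part 106 `Summit.HodgeConjecture.Ring2WeilCoverage.WeilGramLevel28SqrtNegSeven.not_pos_of_principal_sqrtNegSeven`).
research route conditional on HC_CM; not a corollary; Q11.4-sentence-2 already refuted in dim ≥ 3. [cite: vanGeemen1994HodgeAV, Lemma 5.2 (4)] [cite: Shimura1998, §14.3 Prop. 4–5, pp. 103–104] -/
theorem not_pos_of_principal_twentyEight_sqrt_neg_seven [IsCyclotomicExtension {28} ℚ K] [IsCMField K]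
    (hζ : IsPrimitiveRoot ζ 28) (Φ : CMType K)
    (hbal : 2 * ((Finset.univ.filter fun t : ZMod 28 => ∃ σ ∈ Φ.1, σ ζ = 𝐞 t) ∩
        ({3, 5, 13, 17, 19, 27} : Finset (ZMod 28))).card =
      (Finset.univ.filter fun t : ZMod 28 => ∃ σ ∈ Φ.1, σ ζ = 𝐞 t).card)
    {ζ' : K} (hζ' : IsCMField.complexConj K ζ' = -ζ')
    (hT : CMTypeLattice.IsOfType (1 : (FractionalIdeal (𝓞 K)⁰ K)ˣ) ζ' ⊤) :
    ¬ ∀ φ : Φ.1, 0 < (φ.1 ζ').im := by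
  have hs := Summit.HodgeConjecture.Ring2WeilCoverage.WeilGramLevel28SqrtNegSeven.complexConj_sqrtNegSeven hζ
  have hs0 : ((1 + 2 * (ζ ^ 4 + ζ ^ 8 + ζ ^ 16)) : K) ≠ 0 := fun h => by
    have h2 := Summit.HodgeConjecture.Ring2WeilCoverage.WeilGramLevel28SqrtNegSeven.sq_sqrtNegSeven hζ
    rw [h] at h2
    norm_num at h2
  -- balanced for `N_K` ⟺ equal numbers of `φ ∈ Φ` with `Im s^φ < 0` and `> 0` (parts 27/28)
  have heq := (two_mul_card_inter_eq_card_iff hζ (1 + 2 * (ζ ^ 4 + ζ ^ 8 + ζ ^ 16)) (NK := ({3, 5, 13, 17, 19, 27} : Finset (ZMod 28)))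
    (fun φ t hφ ht => ⟨nK_twentyEight_sqrt_neg_seven hφ ht, im_embedding_ne_zero_of_skew hs hs0 φ⟩) Φ).mp hbal
  rw [← card_filter_subtype_eq_ncard Φ (fun ψ => (ψ (1 + 2 * (ζ ^ 4 + ζ ^ 8 + ζ ^ 16))).im < 0),
    ← card_filter_subtype_eq_ncard Φ (fun ψ => 0 < (ψ (1 + 2 * (ζ ^ 4 + ζ ^ 8 + ζ ^ 16))).im)] at heq
  -- the two counts add up to `#Φ = 6`
  have hcardΦ : Fintype.card Φ.1 = 6 := by
    have h := CMTypeLattice.two_mul_card_eq_finrank Φ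
    rw [IsCyclotomicExtension.finrank K (cyclotomic.irreducible_rat (by norm_num : 0 < 28))] at h
    have h12 : Nat.totient 28 = 12 := by decide
    rw [h12] at h
    omega
  have hsum := Finset.card_filter_add_card_filter_not (s := (Finset.univ : Finset Φ.1))
    (fun φ : Φ.1 => 0 < (φ.1 (1 + 2 * (ζ ^ 4 + ζ ^ 8 + ζ ^ 16))).im)
  have hnot : (Finset.univ.filter fun φ : Φ.1 => ¬ 0 < (φ.1 (1 + 2 * (ζ ^ 4 + ζ ^ 8 + ζ ^ 16))).im) =
      Finset.univ.filter fun φ : Φ.1 => (φ.1 (1 + 2 * (ζ ^ 4 + ζ ^ 8 + ζ ^ 16))).im < 0 := by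
    refine Finset.filter_congr fun φ _ => ?_
    have hne := im_embedding_ne_zero_of_skew hs hs0 φ.1
    exact ⟨fun h => lt_of_le_of_ne (not_lt.mp h) hne, fun h => not_lt.mpr h.le⟩
  rw [hnot, Finset.card_univ, hcardΦ] at hsum
  have hneg : (Finset.univ.filter fun φ : Φ.1 => (φ.1 (1 + 2 * (ζ ^ 4 + ζ ^ 8 + ζ ^ 16))).im < 0).card = 3 := by omega
  have hposc : (Finset.univ.filter fun φ : Φ.1 => 0 < (φ.1 (1 + 2 * (ζ ^ 4 + ζ ^ 8 + ζ ^ 16))).im).card = 3 := by omega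
  exact Summit.HodgeConjecture.Ring2WeilCoverage.WeilGramLevel28SqrtNegSeven.not_pos_of_principal_sqrtNegSeven hζ Φ hneg hposc hζ' hT

open scoped Classical in
/-- **The census NO row `(36, ℚ(√−3))` via van Geemen's sign**: for every CM type `Φ` of `ℚ(ζ_36)` balanced for
`N_K = {5, 11, 17, 23, 29, 35}` (the census's Weil-type condition for `ℚ(√−3)`) and every skew `ζ′` of PRINCIPAL type on `ℤ[ζ_36]`, `ζ′`
is not `Φ`-positive — i.e. `ℂ^Φ/Φ(ℤ[ζ_36])` carries no principal `ι`-compatible polarisation (the tree's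
`CyclotomicUnconditional.not_exists_principal_thirtySix`, re-proved: balanced ⟹ `s`-signature `(3,3)` (parts 27/28) ⟹ part 111 `Summit.HodgeConjecture.Ring2WeilCoverage.WeilGramLevel36SqrtNegThree.not_pos_of_principal_sqrtNegThree`).
research route conditional on HC_CM; not a corollary; Q11.4-sentence-2 already refuted in dim ≥ 3. [cite: vanGeemen1994HodgeAV, Lemma 5.2 (4)] [cite: Shimura1998, §14.3 Prop. 4–5, pp. 103–104] -/
theorem not_pos_of_principal_thirtySix_sqrt_neg_three [IsCyclotomicExtension {36} ℚ K] [IsCMField K]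
    (hζ : IsPrimitiveRoot ζ 36) (Φ : CMType K)
    (hbal : 2 * ((Finset.univ.filter fun t : ZMod 36 => ∃ σ ∈ Φ.1, σ ζ = 𝐞 t) ∩
        ({5, 11, 17, 23, 29, 35} : Finset (ZMod 36))).card =
      (Finset.univ.filter fun t : ZMod 36 => ∃ σ ∈ Φ.1, σ ζ = 𝐞 t).card)
    {ζ' : K} (hζ' : IsCMField.complexConj K ζ' = -ζ')
    (hT : CMTypeLattice.IsOfType (1 : (FractionalIdeal (𝓞 K)⁰ K)ˣ) ζ' ⊤) :
    ¬ ∀ φ : Φ.1, 0 < (φ.1 ζ').im := by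
  have hs := Summit.HodgeConjecture.Ring2WeilCoverage.WeilGramLevel36SqrtNegThree.complexConj_sqrtNegThree hζ
  have hs0 : ((1 + 2 * ζ ^ 12) : K) ≠ 0 := fun h => by
    have h2 := Summit.HodgeConjecture.Ring2WeilCoverage.WeilGramLevel36SqrtNegThree.sq_sqrtNegThree hζ
    rw [h] at h2
    norm_num at h2
  -- balanced for `N_K` ⟺ equal numbers of `φ ∈ Φ` with `Im s^φ < 0` and `> 0` (parts 27/28)
  have heq := (two_mul_card_inter_eq_card_iff hζ (1 + 2 * ζ ^ 12) (NK := ({5, 11, 17, 23, 29, 35} : Finset (ZMod 36)))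
    (fun φ t hφ ht => ⟨nK_thirtySix_sqrt_neg_three hφ ht, im_embedding_ne_zero_of_skew hs hs0 φ⟩) Φ).mp hbal
  rw [← card_filter_subtype_eq_ncard Φ (fun ψ => (ψ (1 + 2 * ζ ^ 12)).im < 0),
    ← card_filter_subtype_eq_ncard Φ (fun ψ => 0 < (ψ (1 + 2 * ζ ^ 12)).im)] at heq
  -- the two counts add up to `#Φ = 6`
  have hcardΦ : Fintype.card Φ.1 = 6 := by
    have h := CMTypeLattice.two_mul_card_eq_finrank Φ
    rw [IsCyclotomicExtension.finrank K (cyclotomic.irreducible_rat (by norm_num : 0 < 36))] at h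
    have h12 : Nat.totient 36 = 12 := by decide
    rw [h12] at h
    omega
  have hsum := Finset.card_filter_add_card_filter_not (s := (Finset.univ : Finset Φ.1))
    (fun φ : Φ.1 => 0 < (φ.1 (1 + 2 * ζ ^ 12)).im)
  have hnot : (Finset.univ.filter fun φ : Φ.1 => ¬ 0 < (φ.1 (1 + 2 * ζ ^ 12)).im) =
      Finset.univ.filter fun φ : Φ.1 => (φ.1 (1 + 2 * ζ ^ 12)).im < 0 := by
    refine Finset.filter_congr fun φ _ => ?_
    have hne := im_embedding_ne_zero_of_skew hs hs0 φ.1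
    exact ⟨fun h => lt_of_le_of_ne (not_lt.mp h) hne, fun h => not_lt.mpr h.le⟩
  rw [hnot, Finset.card_univ, hcardΦ] at hsum
  have hneg : (Finset.univ.filter fun φ : Φ.1 => (φ.1 (1 + 2 * ζ ^ 12)).im < 0).card = 3 := by omega
  have hposc : (Finset.univ.filter fun φ : Φ.1 => 0 < (φ.1 (1 + 2 * ζ ^ 12)).im).card = 3 := by omega
  exact Summit.HodgeConjecture.Ring2WeilCoverage.WeilGramLevel36SqrtNegThree.not_pos_of_principal_sqrtNegThree hζ Φ hneg hposc hζ' hT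

end Summit.HodgeConjecture.Ring2WeilCoverage.WeilGramSixfoldNoPrincipalRows

end
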